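import Literature.Topology.FourManifolds.CollarTheorem
import Literature.Topology.FourManifolds.LickorishWallaceProofs
import HarnessLib

/-!
# The boundary of a `4`-dimensional `1`-handlebody is connected: discharge of
`Literature.Topology.FourManifolds.connectedSpace_boundary_of_isHandlebodyOfIndexLE_one`

Topic `Literature/Topology/FourManifolds`; fact seat
`provefact-Literature.Topology.FourManifolds.exists_diffeomorph_comp_incl_eq` (Laudenbach–Poénaru's
extension theorem, `SPC4Handles.lean` (c)), leaf **h₅** of the DAG recorded in
`SPC4HandlesProofs.lean`.  Everything in this file is **proved**.

* `Literature.Topology.FourManifolds.connectedSpace_boundary_of_isHandlebodyOfIndexLE_one_holds` —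
  discharge of the named fact
  `Literature.Topology.FourManifolds.connectedSpace_boundary_of_isHandlebodyOfIndexLE_one` of
  `SPC4HandlesProofs.lean`: for a compact connected smooth `4`-manifold with boundary `V` which
  is a handlebody with handles of index `≤ 1` (`IsHandlebodyOfIndexLE 3 1 V`: a Morse function
  `f` adapted to `∂V` all of whose critical points have index `≤ 1`), the boundary manifold
  `b.carrier ≅ ∂V` of every boundary datum `b` is connected (and nonempty).  Classically this is
  read off `V ≅ ♮k S¹ × B³`, `∂V ≅ #k S¹ × S²` (Kirby, *The topology of `4`-manifolds* (1989),
  Ch. I §2, p. 8), or off the dual handle decomposition (`V` is `∂V × [0, 1]` with handles of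
  index `4 - λ ≥ 3` attached, whose attaching spheres are connected; Milnor, *Morse theory*
  (1963), Thms. 3.1–3.2 and Remark 3.3).  The proof here is the dimension-free theorem
  `Literature.Topology.FourManifolds.IsMorseAdapted.isPreconnected_boundary_and_nonempty` of
  `LickorishWallaceProofs.lean` (the top level `f⁻¹(1) = ∂V` of a Morse function adapted to the
  boundary of a compact connected manifold all of whose critical points have coindex `≥ 2` is
  preconnected and nonempty; elementary, from the Morse lemma and slice charts), applied with
  the slice model `𝓡∂ 4 = 𝓡∂ (3 + 1)` and coindex `4 - λ ≥ 3`; connectedness passes to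
  `b.carrier` through the embedding `b.incl` onto `∂V`.  The orientability hypothesis of the
  fact is not used.
* `Literature.Topology.FourManifolds.exists_diffeomorph_comp_incl_eq_of_laudenbachPoenaru''` — the
  assembly of Laudenbach–Poénaru's extension theorem
  `Literature.Topology.FourManifolds.exists_diffeomorph_comp_incl_eq` from the **three** remaining
  named facts (Lemma 2: automorphisms of `π₁(∂V)` are realised by extendable based
  diffeomorphisms; the orientation-preserving `π₁`-trivial case of the proof of Thm. A; an
  orientation-reversing extendable diffeomorphism acting trivially on `π₁`), the collar fact
  (`CollarTheorem.lean`) and the connectedness of the boundary (this file) being discharged.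

## References

* F. Laudenbach, V. Poénaru, *A note on 4-dimensional handlebodies*, Bull. Soc. Math. France
  100 (1972), 337–344, §2. [LaudenbachPoenaruBSMF1972]
* R. C. Kirby, *The topology of 4-manifolds*, LNM 1374 (1989), Ch. I §2, p. 8. [Kirby1989]
* J. Milnor, *Morse theory*, Ann. of Math. Studies 51 (1963), Thms. 3.1–3.2, Remark 3.3.
  [Milnor1963]
-/

open scoped Manifold ContDiff Topology
open Set Function

noncomputable section

namespace Literature.Topology.FourManifolds

universe u

section SPC4

/-- **Discharge of `Literature.Topology.FourManifolds.connectedSpace_boundary_of_isHandlebodyOfIndexLE_one`.**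
The boundary manifold `b.carrier ≅ ∂V` of a compact connected smooth `4`-dimensional
`1`-handlebody `V` is connected (and nonempty): every critical point of a Morse function
adapted to `∂V` presenting `V` as a `1`-handlebody has index `λ ≤ 1`, hence coindex
`4 - λ ≥ 3 ≥ 2`, so `∂V = f⁻¹(1)` is preconnected and nonempty by
`Literature.Topology.FourManifolds.IsMorseAdapted.isPreconnected_boundary_and_nonempty`
(`LickorishWallaceProofs.lean`), and `b.incl` is an embedding onto `∂V`.  Kirby, *The topology of
`4`-manifolds* (1989), Ch. I §2, p. 8 (`∂(♮k S¹ × B³) = #k S¹ × S²`); Milnor, *Morse theory*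
(1963), Thms. 3.1–3.2 and Remark 3.3 (dual handles of index `≥ 3` have connected attaching
spheres).  The orientability hypothesis is not used. [cite: Kirby1989, Ch. I §2, p. 8] -/
theorem connectedSpace_boundary_of_isHandlebodyOfIndexLE_one_holds :
    connectedSpace_boundary_of_isHandlebodyOfIndexLE_one.{u} := by
  intro V _ _ _ _ _ _ _ hV _ b
  haveI : LocallyPathConnectedSpace V :=
    ChartedSpace.locallyPathConnectedSpace (EuclideanHalfSpace 4) V
  obtain ⟨f, hf, hle⟩ := hV
  have hidx : ∀ x, (𝓡∂ (3 + 1)).IsInteriorPoint x → IsMCriticalPt (𝓡∂ (3 + 1)) f x →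
      morseIndex (𝓡∂ (3 + 1)) f x + 2 ≤ 3 + 1 := fun x _ hx => by
    have h : morseIndex (𝓡∂ (3 + 1)) f x ≤ 1 := hle x hx
    omega
  obtain ⟨hpre, hne⟩ := hf.isPreconnected_boundary_and_nonempty hidx
  have hrange := b.range_incl
  have hind : Topology.IsInducing b.incl := b.isSmoothEmbedding.isEmbedding.isInducing
  rw [connectedSpace_iff_univ]
  refine ⟨?_, ?_⟩
  · obtain ⟨y, hy⟩ := hne
    rw [← hrange] at hy
    obtain ⟨c, rfl⟩ := hy
    exact ⟨c, mem_univ c⟩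
  · rw [← hind.isPreconnected_image, image_univ, hrange]
    exact hpre

/-- **Assembly of Laudenbach–Poénaru's extension theorem from the three remaining named facts.**
`Literature.Topology.FourManifolds.exists_diffeomorph_comp_incl_eq` (every self-diffeomorphism of
the boundary of a compact connected orientable `4`-dimensional `1`-handlebody `V ≅ ♮k S¹ × B³`
extends over `V`) follows from Laudenbach–Poénaru's Lemma 2
(`laudenbachPoenaru_exists_diffeoExtends_mapOfEq_eq`), the orientation-preserving `π₁`-trivial
case of the proof of Thm. A (`laudenbachPoenaru_diffeoExtends_of_isOrientationPreserving`) and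
the orientation-reversing extendable diffeomorphism acting trivially on `π₁`
(`exists_diffeoExtends_isOrientationReversing`); the collar fact is discharged in
`CollarTheorem.lean` and the connectedness of the boundary above
(`Literature.Topology.FourManifolds.exists_diffeomorph_comp_incl_eq_of_laudenbachPoenaru'` with
`connectedSpace_boundary_of_isHandlebodyOfIndexLE_one_holds`).
[cite: LaudenbachPoenaruBSMF1972, §2, pp. 341–342] -/
theorem exists_diffeomorph_comp_incl_eq_of_laudenbachPoenaru''
    (h₁ : laudenbachPoenaru_exists_diffeoExtends_mapOfEq_eq.{u})
    (h₂ : laudenbachPoenaru_diffeoExtends_of_isOrientationPreserving.{u})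
    (h₃ : exists_diffeoExtends_isOrientationReversing.{u}) :
    exists_diffeomorph_comp_incl_eq.{u} :=
  exists_diffeomorph_comp_incl_eq_of_laudenbachPoenaru' h₁ h₂ h₃
    connectedSpace_boundary_of_isHandlebodyOfIndexLE_one_holds

end SPC4

end Literature.Topology.FourManifolds
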